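import Mathlib
import Literature.Computability.AlgebraicComplexity.ArithCircuitProofs
import Summits.ValiantsHypothesis.ValiantsHypothesis.Theorems.FifoMatchingNNDivisionHardPolylogArcFaces
import HarnessLib

/-!
# Route FifoMatching — crux `NNDivisionHard` (stmt-ValiantsHypothesis-21181): EVERY QUASI-POLYNOMIAL CERTIFICATE HAS A
# COFACTOR OF MONOTONE COMPLEXITY `≥ n / polylog n` — the Newton dimension is at most twice the monotone circuit size

The Newton-dimension tier (`…NewtonDimension`, `…PolylogArcFaces`, this hand) says: a cofactor whose support spans an affine
space of dimension `D` with `(D + 1)(log₂ n)^k ≤ n` is not a certificate.  This file bounds `D` by the COMPLEXITY of the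
cofactor: in a monotone circuit over `ℝ≥0` (no cancellation) the affine span of the support of a product gate is spanned by
those of its operands (`Newt(fg) = Newt f + Newt g`), and that of a sum gate by those of its operands and ONE more vector
joining them (`Newt(f + g) = conv(Newt f ∪ Newt g)`); inputs and constants are points.  Hence every gate adds at most its
fan-in many directions:

* `vectorSpan_union_le` — `dir aff(A ∪ B) ≤ dir aff A ⊔ dir aff B ⊔ ℚ(a₀ − b₀)`; `vs_mul_le`, `vs_smul_add_le`, `vs_le_of_subsingleton`;
* ★★ `finrank_vectorSpan_support_le_two_mul_complexity` — **`dim Newt(h) ≤ 2 · L₊(h)`** for every `h ∈ ℝ≥0[σ]` (fan-in-two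
  monotone circuits; the factor `2` is the fan-in);
* ★★★ `cheapCofactor_not_certificate_qp` — **for every `c` there are `k, n₀` with: for all `n ≥ n₀`, every `h ≠ 0` with
  `(2 L₊(h) + 1)(log₂ n)^k ≤ n` satisfies `2^((log₂ n + c)^c) < L₊(NN_n · h) + L₊(h)`** — COFACTORS OF MONOTONE COMPLEXITY
  `≤ n / (log₂ n)^k` ARE NOT CERTIFICATES, whatever their degree and support;
* ★★ `certificate_cofactor_complexity_lower_bound` — contrapositive in the residual's language: eventually every
  quasi-polynomial certificate `L₊(NN_n · h) + L₊(h) ≤ 2^((log₂ n + c)^c)`, `h ≠ 0`, has `n < (2 L₊(h) + 1)(log₂ n)^k`.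
  (The earlier charged bound of the tree was `⌊n^{1/8}⌋ < L₊(h)`-type, `…CofactorCost.nnDivisionHard_expCharged`.)

HONEST FRAMING: a rung toward ONE crux — the cofactor of a certificate is itself expensive (`n^{1−o(1)}` gates), nothing is said
about cofactors of complexity between `n/polylog` and `2^{polylog}`; stmt-21181 stays OPEN; nothing here bears on `NNNotVP` or
on VP ≠ VNP (NOT proved).  No definitions, no named facts.
References: Bürgisser 2000 Def. 2.1 [Burgisser2000]; Hrubeš–Yehudayoff 2021 §6 Problem 2 [HrubesYehudayoff2021].
-/

noncomputable section

-- Sub = Summit single-conjunct layout: the duplicated namespace component is mandated by the tree.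
set_option linter.dupNamespace false
set_option autoImplicit false

namespace Summit.ValiantsHypothesis.ValiantsHypothesis.Theorems.FifoMatching.NNDivisionHard.CofactorComplexityLowerBound

open Finset MvPolynomial Literature.Computability.AlgebraicComplexity
open Literature.Computability.AlgebraicComplexity.ArithCircuit
open Summit.ValiantsHypothesis.ValiantsHypothesis.Theorems.FifoMatching.NNDivisionHard.PolylogArcFaces
  (polylogNewtonDim_not_certificate_qp')
open scoped NNReal BigOperators

/-! ### §1 Affine spans: unions, Minkowski sums -/

section LinAlg

variable {V : Type*} [AddCommGroup V] [Module ℚ V]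

/-- `dir aff(A ∪ B) ≤ dir aff A ⊔ dir aff B ⊔ ℚ ∙ (a₀ − b₀)` for `a₀ ∈ A`, `b₀ ∈ B`. [folklore] -/
theorem vectorSpan_union_le {A B : Set V} {a₀ b₀ : V} (ha : a₀ ∈ A) (hb : b₀ ∈ B) :
    vectorSpan ℚ (A ∪ B) ≤ vectorSpan ℚ A ⊔ vectorSpan ℚ B ⊔ ℚ ∙ (a₀ -ᵥ b₀) := by
  rw [vectorSpan_def]
  refine Submodule.span_le.2 ?_
  intro v hv
  obtain ⟨x, hx, y, hy, rfl⟩ := Set.mem_vsub.1 hv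
  have hd : a₀ -ᵥ b₀ ∈ vectorSpan ℚ A ⊔ vectorSpan ℚ B ⊔ ℚ ∙ (a₀ -ᵥ b₀) :=
    Submodule.mem_sup_right (Submodule.mem_span_singleton_self _)
  have hA : ∀ p ∈ A, ∀ q ∈ A, p -ᵥ q ∈ vectorSpan ℚ A ⊔ vectorSpan ℚ B ⊔ ℚ ∙ (a₀ -ᵥ b₀) := fun p hp q hq =>
    Submodule.mem_sup_left (Submodule.mem_sup_left (vsub_mem_vectorSpan ℚ hp hq))
  have hB : ∀ p ∈ B, ∀ q ∈ B, p -ᵥ q ∈ vectorSpan ℚ A ⊔ vectorSpan ℚ B ⊔ ℚ ∙ (a₀ -ᵥ b₀) := fun p hp q hq =>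
    Submodule.mem_sup_left (Submodule.mem_sup_right (vsub_mem_vectorSpan ℚ hp hq))
  rcases hx with hx | hx <;> rcases hy with hy | hy
  · exact hA x hx y hy
  · have : x -ᵥ y = (x -ᵥ a₀) + (a₀ -ᵥ b₀) + (b₀ -ᵥ y) := by simp [vsub_eq_sub]
    rw [this]
    exact Submodule.add_mem _ (Submodule.add_mem _ (hA x hx a₀ ha) hd) (hB b₀ hb y hy)
  · have : x -ᵥ y = (x -ᵥ b₀) - (a₀ -ᵥ b₀) + (a₀ -ᵥ y) := by simp [vsub_eq_sub]
    rw [this]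
    exact Submodule.add_mem _ (Submodule.sub_mem _ (hB x hx b₀ hb) hd) (hA a₀ ha y hy)
  · exact hB x hx y hy

end LinAlg

/-! ### §2 The affine span of the support of a gate value -/

section Poly

variable {σ : Type*}

/-- A polynomial with at most one monomial has a zero-dimensional Newton polytope. [folklore] -/
theorem vs_le_of_subsingleton {p : MvPolynomial σ ℝ≥0} {d : σ →₀ ℕ} (hp : p.support ⊆ {d})
    (W : Submodule ℚ (σ → ℚ)) :
    vectorSpan ℚ ((fun u : σ →₀ ℕ => fun a : σ => (u a : ℚ)) '' (p.support : Set (σ →₀ ℕ))) ≤ W := by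
  have hsub : ((fun u : σ →₀ ℕ => fun a : σ => (u a : ℚ)) '' (p.support : Set (σ →₀ ℕ))) ⊆
      {fun a : σ => (d a : ℚ)} := by
    rintro x ⟨u, hu, rfl⟩
    have := hp (Finset.mem_coe.1 hu)
    rw [Finset.mem_singleton] at this
    simp [this]
  exact (vectorSpan_mono ℚ hsub).trans (by rw [vectorSpan_singleton]; exact bot_le)

/-- `Newt(p q) = Newt p + Newt q`: the direction space of a product is spanned by those of the factors. [folklore] -/
theorem vs_mul_le (p q : MvPolynomial σ ℝ≥0) :
    vectorSpan ℚ ((fun u : σ →₀ ℕ => fun a : σ => (u a : ℚ)) '' ((p * q).support : Set (σ →₀ ℕ))) ≤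
      vectorSpan ℚ ((fun u : σ →₀ ℕ => fun a : σ => (u a : ℚ)) '' (p.support : Set (σ →₀ ℕ))) ⊔
        vectorSpan ℚ ((fun u : σ →₀ ℕ => fun a : σ => (u a : ℚ)) '' (q.support : Set (σ →₀ ℕ))) := by
  classical
  rw [vectorSpan_def]
  refine Submodule.span_le.2 ?_
  intro v hv
  obtain ⟨x, ⟨d₁, hd₁, rfl⟩, y, ⟨d₂, hd₂, rfl⟩, rfl⟩ := Set.mem_vsub.1 hv
  obtain ⟨a₁, ha₁, b₁, hb₁, rfl⟩ := Finset.mem_add.1 (support_mul p q (Finset.mem_coe.1 hd₁))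
  obtain ⟨a₂, ha₂, b₂, hb₂, rfl⟩ := Finset.mem_add.1 (support_mul p q (Finset.mem_coe.1 hd₂))
  have hsplit : ((fun a : σ => ((a₁ + b₁) a : ℚ)) -ᵥ (fun a : σ => ((a₂ + b₂) a : ℚ))) =
      ((fun a : σ => (a₁ a : ℚ)) -ᵥ (fun a : σ => (a₂ a : ℚ))) +
        ((fun a : σ => (b₁ a : ℚ)) -ᵥ (fun a : σ => (b₂ a : ℚ))) := by
    funext a
    simp only [vsub_eq_sub, Pi.sub_apply, Pi.add_apply, Finsupp.coe_add, Nat.cast_add]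
    ring
  rw [SetLike.mem_coe, hsplit]
  exact Submodule.add_mem _
    (Submodule.mem_sup_left (vsub_mem_vectorSpan ℚ (Set.mem_image_of_mem _ (Finset.mem_coe.2 ha₁))
      (Set.mem_image_of_mem _ (Finset.mem_coe.2 ha₂))))
    (Submodule.mem_sup_right (vsub_mem_vectorSpan ℚ (Set.mem_image_of_mem _ (Finset.mem_coe.2 hb₁))
      (Set.mem_image_of_mem _ (Finset.mem_coe.2 hb₂))))

/-- `Newt(c p + q) ⊆ conv(Newt p ∪ Newt q)`: a weighted sum adds at most ONE direction to those of its operands. [folklore] -/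
theorem vs_smul_add_le (c : ℝ≥0) (p q : MvPolynomial σ ℝ≥0) (W : Submodule ℚ (σ → ℚ))
    (hp : vectorSpan ℚ ((fun u : σ →₀ ℕ => fun a : σ => (u a : ℚ)) '' (p.support : Set (σ →₀ ℕ))) ≤ W)
    (hq : vectorSpan ℚ ((fun u : σ →₀ ℕ => fun a : σ => (u a : ℚ)) '' (q.support : Set (σ →₀ ℕ))) ≤ W) :
    ∃ v : σ → ℚ, vectorSpan ℚ ((fun u : σ →₀ ℕ => fun a : σ => (u a : ℚ)) '' ((c • p + q).support : Set (σ →₀ ℕ))) ≤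
      W ⊔ ℚ ∙ v := by
  classical
  have hsub : ((c • p + q).support : Set (σ →₀ ℕ)) ⊆ (p.support : Set (σ →₀ ℕ)) ∪ (q.support : Set (σ →₀ ℕ)) := by
    intro d hd
    have h1 := support_add (Finset.mem_coe.1 hd)
    rcases Finset.mem_union.1 h1 with h | h
    · exact Or.inl (Finset.mem_coe.2 (support_smul h))
    · exact Or.inr (Finset.mem_coe.2 h)
  have hmono := vectorSpan_mono ℚ (Set.image_mono hsub (f := fun u : σ →₀ ℕ => fun a : σ => (u a : ℚ)))
  rw [Set.image_union] at hmono
  by_cases hp0 : p.support = ∅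
  · refine ⟨0, (hmono.trans ?_)⟩
    rw [hp0, Finset.coe_empty, Set.image_empty, Set.empty_union]
    exact hq.trans le_sup_left
  by_cases hq0 : q.support = ∅
  · refine ⟨0, (hmono.trans ?_)⟩
    rw [hq0, Finset.coe_empty, Set.image_empty, Set.union_empty]
    exact hp.trans le_sup_left
  obtain ⟨a₀, ha₀⟩ := Finset.nonempty_iff_ne_empty.2 hp0
  obtain ⟨b₀, hb₀⟩ := Finset.nonempty_iff_ne_empty.2 hq0
  refine ⟨(fun a : σ => (a₀ a : ℚ)) -ᵥ (fun a : σ => (b₀ a : ℚ)), hmono.trans ?_⟩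
  refine (vectorSpan_union_le (Set.mem_image_of_mem _ (Finset.mem_coe.2 ha₀))
    (Set.mem_image_of_mem _ (Finset.mem_coe.2 hb₀))).trans ?_
  exact sup_le (sup_le (hp.trans le_sup_left) (hq.trans le_sup_left)) le_sup_right

end Poly

/-! ### §3 Circuits: every gate adds at most two directions -/

section Circuit

variable {σ : Type*}

/-- Operands: inputs and constants are points, gate references are covered by the invariant (junk references are `0`).
[cite: Burgisser2000, Def. 2.1] -/
theorem vs_operand_le (vals : List (MvPolynomial σ ℝ≥0)) (W : Submodule ℚ (σ → ℚ))
    (hvals : ∀ v ∈ vals, vectorSpan ℚ ((fun u : σ →₀ ℕ => fun a : σ => (u a : ℚ)) '' (v.support : Set (σ →₀ ℕ))) ≤ W)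
    (u : Operand ℝ≥0 σ) :
    vectorSpan ℚ ((fun u : σ →₀ ℕ => fun a : σ => (u a : ℚ)) '' ((u.eval vals).support : Set (σ →₀ ℕ))) ≤ W := by
  cases u with
  | var i => exact vs_le_of_subsingleton (d := Finsupp.single i 1) (by rw [Operand.eval]; exact support_X.subset) W
  | const c => exact vs_le_of_subsingleton (d := 0) (by rw [Operand.eval]; exact support_monomial_subset) W
  | gate j =>
    rw [Operand.eval_gate]
    by_cases hj : j < vals.length
    · rw [List.getD_eq_getElem _ _ hj]
      exact hvals _ (List.getElem_mem hj)
    · rw [List.getD_eq_default _ _ (not_lt.1 hj)]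
      exact vs_le_of_subsingleton (d := 0) (by simp) W

/-- Product gates add no direction. [cite: Burgisser2000, Def. 2.1] -/
theorem vs_prod_le (vals : List (MvPolynomial σ ℝ≥0)) (W : Submodule ℚ (σ → ℚ))
    (hvals : ∀ v ∈ vals, vectorSpan ℚ ((fun u : σ →₀ ℕ => fun a : σ => (u a : ℚ)) '' (v.support : Set (σ →₀ ℕ))) ≤ W)
    (args : List (Operand ℝ≥0 σ)) :
    vectorSpan ℚ ((fun u : σ →₀ ℕ => fun a : σ => (u a : ℚ)) ''
      (((args.map fun u : Operand ℝ≥0 σ => u.eval vals).prod).support : Set (σ →₀ ℕ))) ≤ W := by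
  induction args with
  | nil =>
    rw [List.map_nil, List.prod_nil]
    exact vs_le_of_subsingleton (d := 0) (by rw [← C_1]; exact support_monomial_subset) W
  | cons u rest ih =>
    rw [List.map_cons, List.prod_cons]
    exact (vs_mul_le _ _).trans (sup_le (vs_operand_le vals W hvals u) ih)

/-- Sum gates add at most one direction per operand. [cite: Burgisser2000, Def. 2.1] -/
theorem vs_sum_le (vals : List (MvPolynomial σ ℝ≥0)) (T : List (σ → ℚ))
    (hvals : ∀ v ∈ vals, vectorSpan ℚ ((fun u : σ →₀ ℕ => fun a : σ => (u a : ℚ)) '' (v.support : Set (σ →₀ ℕ))) ≤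
      Submodule.span ℚ {x | x ∈ T})
    (args : List (ℝ≥0 × Operand ℝ≥0 σ)) :
    ∃ J : List (σ → ℚ), J.length ≤ args.length ∧
      vectorSpan ℚ ((fun u : σ →₀ ℕ => fun a : σ => (u a : ℚ)) ''
        (((args.map fun a : ℝ≥0 × Operand ℝ≥0 σ => a.1 • a.2.eval vals).sum).support : Set (σ →₀ ℕ))) ≤
        Submodule.span ℚ {x | x ∈ T ++ J} := by
  induction args with
  | nil =>
    refine ⟨[], le_rfl, ?_⟩
    rw [List.map_nil, List.sum_nil]
    exact vs_le_of_subsingleton (d := 0) (by simp) _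
  | cons a rest ih =>
    obtain ⟨J, hJ, hrest⟩ := ih
    have hmonoT : Submodule.span ℚ {x | x ∈ T} ≤ Submodule.span ℚ {x | x ∈ T ++ J} :=
      Submodule.span_mono fun x hx => by simp only [Set.mem_setOf_eq, List.mem_append] at hx ⊢; exact Or.inl hx
    have hop := (vs_operand_le vals _ hvals a.2).trans hmonoT
    obtain ⟨v, hv⟩ := vs_smul_add_le a.1 (a.2.eval vals)
      ((rest.map fun a : ℝ≥0 × Operand ℝ≥0 σ => a.1 • a.2.eval vals).sum) _ hop hrest
    refine ⟨J ++ [v], by simp [hJ], ?_⟩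
    rw [List.map_cons, List.sum_cons]
    refine hv.trans (sup_le (Submodule.span_mono fun x hx => ?_) ?_)
    · simp only [Set.mem_setOf_eq, List.mem_append] at hx ⊢
      rcases hx with hx | hx
      · exact Or.inl hx
      · exact Or.inr (Or.inl hx)
    · rw [Submodule.span_singleton_le_iff_mem]
      exact Submodule.subset_span (by simp)

/-- ★ **The invariant**: after the gates `gs` (fan-in two), all gate values have supports whose affine spans lie in a common
space spanned by at most `2 |gs|` vectors. [cite: Burgisser2000, Def. 2.1] -/
theorem exists_span_gateValues (gs : List (Gate ℝ≥0 σ)) (h2 : ∀ g ∈ gs, g.fanIn ≤ 2) :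
    ∃ T : List (σ → ℚ), T.length ≤ 2 * gs.length ∧
      ∀ v ∈ gateValues gs, vectorSpan ℚ ((fun u : σ →₀ ℕ => fun a : σ => (u a : ℚ)) '' (v.support : Set (σ →₀ ℕ))) ≤
        Submodule.span ℚ {x | x ∈ T} := by
  induction gs using List.reverseRecOn with
  | nil => exact ⟨[], le_rfl, fun v hv => by simp [gateValues] at hv⟩
  | append_singleton gs g ih =>
    obtain ⟨T, hT, hvals⟩ := ih fun g' hg' => h2 g' (List.mem_append_left _ hg')
    have hg2 : g.fanIn ≤ 2 := h2 g (List.mem_append_right _ (List.mem_singleton_self g))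
    rw [gateValues_append_singleton]
    cases g with
    | sum args =>
      obtain ⟨J, hJ, hsum⟩ := vs_sum_le (gateValues gs) T hvals args
      have hlen : args.length ≤ 2 := by
        simpa [Gate.fanIn, Gate.args] using hg2
      refine ⟨T ++ J, by simp; omega, fun v hv => ?_⟩
      rcases List.mem_append.1 hv with hv | hv
      · exact (hvals v hv).trans (Submodule.span_mono fun x hx => by
          simp only [Set.mem_setOf_eq, List.mem_append] at hx ⊢; exact Or.inl hx)
      · rw [List.mem_singleton] at hv
        rw [hv, Gate.eval]
        exact hsum
    | prod args =>
      refine ⟨T, by simp; omega, fun v hv => ?_⟩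
      rcases List.mem_append.1 hv with hv | hv
      · exact hvals v hv
      · rw [List.mem_singleton] at hv
        rw [hv, Gate.eval]
        exact vs_prod_le (gateValues gs) _ hvals args

/-- ★★ **`dim Newt(h) ≤ 2 · L₊(h)`**: the support of a polynomial of monotone (fan-in-two) circuit complexity `s` over `ℝ≥0`
spans an affine space of dimension at most `2s`. [cite: Burgisser2000, Def. 2.1] -/
theorem finrank_vectorSpan_support_le_two_mul_complexity [Fintype σ] (h : MvPolynomial σ ℝ≥0) :
    Module.finrank ℚ (vectorSpan ℚ ((fun u : σ →₀ ℕ => fun a : σ => (u a : ℚ)) '' (h.support : Set (σ →₀ ℕ)))) ≤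
      2 * complexity h := by
  classical
  obtain ⟨P, hP2, hP, hsize⟩ := exists_computes_size_eq_complexity h
  obtain ⟨T, hT, hvals⟩ := exists_span_gateValues P.gates hP2
  have hout := vs_operand_le (gateValues P.gates) _ hvals P.output
  have hev : P.output.eval (gateValues P.gates) = h := hP
  rw [hev] at hout
  have hset : {x | x ∈ T} = (T.toFinset : Set (σ → ℚ)) := by ext x; simp
  rw [hset] at hout
  calc Module.finrank ℚ (vectorSpan ℚ ((fun u : σ →₀ ℕ => fun a : σ => (u a : ℚ)) '' (h.support : Set (σ →₀ ℕ))))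
      ≤ Module.finrank ℚ (Submodule.span ℚ (T.toFinset : Set (σ → ℚ))) := Submodule.finrank_mono hout
    _ ≤ T.toFinset.card := finrank_span_finset_le_card _
    _ ≤ T.length := List.toFinset_card_le T
    _ ≤ 2 * complexity h := by rw [← hsize]; exact hT

end Circuit

/-! ### §4 Cheap cofactors are not certificates -/

/-- ★★★ **COFACTORS OF MONOTONE COMPLEXITY `≤ n / polylog n` ARE NOT CERTIFICATES.**  For every `c` there are `k, n₀` with:
for all `n ≥ n₀`, every `h ≠ 0` with `(2 L₊(h) + 1)(log₂ n)^k ≤ n` satisfies `2^((log₂ n + c)^c) < L₊(NN_n · h) + L₊(h)`.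
[cite: HrubesYehudayoff2021, §6 Problem 2] [cite: Burgisser2000, Def. 2.1] -/
theorem cheapCofactor_not_certificate_qp (c : ℕ) : ∃ k n₀ : ℕ, ∀ n : ℕ, n₀ ≤ n →
    ∀ h : MvPolynomial (Fin (2 * n) × Fin (2 * n)) ℝ≥0, h ≠ 0 → (2 * complexity h + 1) * (Nat.log 2 n) ^ k ≤ n →
      2 ^ ((Nat.log 2 n + c) ^ c) < complexity (nestFreeMatchingPoly n ℝ≥0 * h) + complexity h := by
  obtain ⟨k, n₀, hk⟩ := polylogNewtonDim_not_certificate_qp' c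
  refine ⟨k, n₀, fun n hn h hh hL => hk n hn h hh (le_trans (Nat.mul_le_mul_right _ ?_) hL)⟩
  exact Nat.add_le_add_right (finrank_vectorSpan_support_le_two_mul_complexity h) 1

/-- ★★ **Every quasi-polynomial certificate has an expensive cofactor**: for every `c` there are `k, n₀` with: for all
`n ≥ n₀`, every `h ≠ 0` with `L₊(NN_n · h) + L₊(h) ≤ 2^((log₂ n + c)^c)` has `n < (2 L₊(h) + 1)(log₂ n)^k`.
[cite: HrubesYehudayoff2021, §6 Problem 2] -/
theorem certificate_cofactor_complexity_lower_bound (c : ℕ) : ∃ k n₀ : ℕ, ∀ n : ℕ, n₀ ≤ n →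
    ∀ h : MvPolynomial (Fin (2 * n) × Fin (2 * n)) ℝ≥0, h ≠ 0 →
      complexity (nestFreeMatchingPoly n ℝ≥0 * h) + complexity h ≤ 2 ^ ((Nat.log 2 n + c) ^ c) →
      n < (2 * complexity h + 1) * (Nat.log 2 n) ^ k := by
  obtain ⟨k, n₀, hk⟩ := cheapCofactor_not_certificate_qp c
  refine ⟨k, n₀, fun n hn h hh hcert => ?_⟩
  by_contra hle
  push Not at hle
  exact absurd (hk n hn h hh hle) (not_lt.2 hcert)

/-- ★ **BY NAME: `NNDivisionHard` ⟺ its tier of EXPENSIVE cofactors** (for every `c` AND every `k`, eventually, the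
cofactors with `n < (2 L₊(h) + 1)(log₂ n)^k`). [cite: HrubesYehudayoff2021, §6 Problem 2] -/
theorem nnDivisionHard_iff_expensiveCofactorTier :
    Summit.ValiantsHypothesis.ValiantsHypothesis.Theses.FifoMatching.NNDivisionHard ↔
    ∀ c k : ℕ, ∃ n₀ : ℕ, ∀ n ≥ n₀, ∀ h : MvPolynomial (Fin (2 * n) × Fin (2 * n)) ℝ≥0, h ≠ 0 →
      n < (2 * complexity h + 1) * (Nat.log 2 n) ^ k →
      2 ^ ((Nat.log 2 n + c) ^ c) < complexity (nestFreeMatchingPoly n ℝ≥0 * h) + complexity h := by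
  constructor
  · intro hN c k
    obtain ⟨n₀, hn₀⟩ := hN c
    exact ⟨n₀, fun n hn h hh _ => hn₀ n hn h hh⟩
  · intro H c
    obtain ⟨k₁, n₁, hn₁⟩ := cheapCofactor_not_certificate_qp c
    obtain ⟨n₀, hn₀⟩ := H c k₁
    refine ⟨max n₀ n₁, fun n hn h hh => ?_⟩
    by_cases hcheap : (2 * complexity h + 1) * (Nat.log 2 n) ^ k₁ ≤ n
    · exact hn₁ n (le_trans (le_max_right _ _) hn) h hh hcheap
    · exact hn₀ n (le_trans (le_max_left _ _) hn) h hh (not_le.1 hcheap)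

end Summit.ValiantsHypothesis.ValiantsHypothesis.Theorems.FifoMatching.NNDivisionHard.CofactorComplexityLowerBound

end
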